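/-
Copyright (c) 2026. All rights reserved.
Released under Apache 2.0 license as described in the file LICENSE.
Authors: abc-iut cell — seat abc-iut-w4-d104 (gen 2): the sub-collection `ℛ(U)` of rectangles named in
[AbsTopIII] Prop 2.5 / Rmk 2.5.1 (not defined in `HolomorphicCores.lean`), and the instantiation of the
Prop 2.6 orthogonal-frame bridge at it.
-/
import Literature.AnabelianGeometry.AbsoluteAnabelian.HolomorphicCoresOrthFrameBridge
import HarnessLib

/-!
# [AbsTopIII] Prop 2.5 / Rmk 2.5.1: the rectangles `ℛ(U)`

S. Mochizuki, *Topics in absolute anabelian geometry III*, Prop 2.5 (kurims p.55) works with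
`𝒬 ∈ {𝒫, ℛ, 𝒮}` — "parallelograms, rectangles, or squares" — and Rmk 2.5.1 (p.57) defines: "a frame at `p`
is orthogonal if it arises from an ordered pair of distinct intersecting sides of a rectangle
`∈ ℛ(U) ⊆ 𝒫(U)`" (bib key `MochizukiAbsTopIII2015`).  `HolomorphicCores.lean` (abc-iut-L4-t14, FROZEN)
defines `parallelogramsIn` (`𝒫`) and `squaresIn` (`𝒮`) and mentions "`ℛ(U)` (rectangles: `w ⊥ v`)" only
in a docstring; its `Parallelograms.IsOrthogonalFrame` takes the collection of rectangles as a PARAMETER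
`ℛ`.  This file supplies the one missing definition, in the same shape as `squaresIn`:

* `rectanglesIn U` — `ℛ(U)`: pre-compact open parallelograms in `U` with `ℝ`-independent ORTHOGONAL edge
  vectors; `squaresIn U ⊆ rectanglesIn U ⊆ parallelogramsIn U`;
* the instantiation of the Prop 2.6 (a) orthogonal-frame BRIDGE of `HolomorphicCoresOrthFrameBridge.lean`
  (stated there for a parameter `ℛ` pinned by a hypothesis `hℛ`, which `rectanglesIn` satisfies by
  `Iff.rfl`): `Parallelograms.isOrthogonalFrame_rectangles_iff` (Rmk 2.5.1: orthogonal frame ⟺ orthogonal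
  corner vectors), `LocGerm.preservesOrthFrames_iff_rectangles`, `mem_germAut_iff_rectangles`
  (`𝒜_p = germAut p` characterised by the three printed conditions read against the abstract notions of
  Prop 2.5 over `(U, 𝒬)`, `𝒮(U) ⊆ 𝒬 ⊆ 𝒫(U)`).

Refereed pre-IUT material; nothing here bears on the disputed [IUTchIII] Cor. 3.12; typed ≠ endorsed.
-/

namespace Literature.AnabelianGeometry.AbsoluteAnabelian

open _root_.Complex _root_.Set _root_.Topology _root_.Filter _root_.Metric
open scoped InnerProductSpace

noncomputable section

/-- **`ℛ(U)`**: the pre-compact RECTANGLES in `U ⊆ ℂ` — open parallelograms `openParallelogram z v w` with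
`ℝ`-independent, ORTHOGONAL edge vectors `v ⊥ w` and closure contained in `U` (Prop 2.5: "`𝒬 ∈ {𝒫, ℛ, 𝒮}`
… parallelograms, rectangles, or squares"; the sub-collection `ℛ(U) ⊆ 𝒫(U)` of Rmk 2.5.1).
[cite: MochizukiAbsTopIII2015, Proposition 2.5 p.55] -/
def rectanglesIn (U : Set ℂ) : Set (Set ℂ) :=
  {P | ∃ z v w : ℂ, LinearIndependent ℝ ![v, w] ∧ ⟪v, w⟫_ℝ = 0 ∧ P = openParallelogram z v w ∧ closure P ⊆ U}

/-- `ℛ(U) ⊆ 𝒫(U)`. [cite: MochizukiAbsTopIII2015, Remark 2.5.1 p.57] -/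
theorem rectanglesIn_subset_parallelogramsIn (U : Set ℂ) : rectanglesIn U ⊆ parallelogramsIn U := by
  rintro P ⟨z, v, w, hvw, -, hP, hcl⟩
  exact ⟨z, v, w, hvw, hP, hcl⟩

/-- `𝒮(U) ⊆ ℛ(U)`: a square `(v, i v)` is a rectangle. [cite: MochizukiAbsTopIII2015, Proposition 2.5 p.55] -/
theorem squaresIn_subset_rectanglesIn (U : Set ℂ) : squaresIn U ⊆ rectanglesIn U := by
  rintro P ⟨z, v, hv, hP, hcl⟩
  refine ⟨z, v, Complex.I * v, linearIndependent_pair_mul_I hv, ?_, hP, hcl⟩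
  rw [Complex.inner, Complex.mul_re, Complex.conj_re, Complex.conj_im]
  simp only [Complex.mul_re, Complex.mul_im, Complex.I_re, Complex.I_im, zero_mul, one_mul]
  ring

/-- The collection of rectangles of the abstract space `U` (as subsets of the subtype): membership unfolds
to the hypothesis `hℛ` of `HolomorphicCoresOrthFrameBridge.lean` DEFINITIONALLY.
[cite: MochizukiAbsTopIII2015, Remark 2.5.1 p.57] -/
theorem mem_rectangles_iff (U : Set ℂ) (R : Set U) :
    R ∈ {R : Set U | Subtype.val '' R ∈ rectanglesIn U} ↔
      ∃ z v w : ℂ, LinearIndependent ℝ ![v, w] ∧ ⟪v, w⟫_ℝ = 0 ∧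
        Subtype.val '' R = openParallelogram z v w ∧ closure (Subtype.val '' R) ⊆ U :=
  Iff.rfl

section Instances

variable {U : Set ℂ} (hU : IsOpen U) {𝒬 : Set (Set U)}
  (h𝒬 : ∀ Q ∈ 𝒬, Subtype.val '' Q ∈ parallelogramsIn U)
  (h𝒮 : ∀ Q : Set U, Subtype.val '' Q ∈ squaresIn U → Q ∈ 𝒬)

include hU h𝒬 h𝒮 in
/-- **Rmk 2.5.1 at `ℛ(U)`**: for `𝒮(U) ⊆ 𝒬 ⊆ 𝒫(U)`, a pair of sides `F = (S₁, S₂)` is an ORTHOGONAL FRAME at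
`p` — "arises from an ordered pair of distinct intersecting sides of a rectangle `∈ ℛ(U)`" — IFF
`val '' Sᵢ = [p, p + eᵢ]` for `ℝ`-independent orthogonal corner vectors `e₁ ⊥ e₂` with the closed
parallelogram at `p` inside `U`. [cite: MochizukiAbsTopIII2015, Remark 2.5.1 p.57] -/
theorem Parallelograms.isOrthogonalFrame_rectangles_iff {p : U} {F : Set U × Set U} :
    Parallelograms.IsOrthogonalFrame 𝒬 {R : Set U | Subtype.val '' R ∈ rectanglesIn U} p F ↔
      ∃ e₁ e₂ : ℂ, LinearIndependent ℝ ![e₁, e₂] ∧ ⟪e₁, e₂⟫_ℝ = 0 ∧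
        closure (openParallelogram (p : ℂ) e₁ e₂) ⊆ U ∧
        Subtype.val '' F.1 = segment ℝ (p : ℂ) (p + e₁) ∧
        Subtype.val '' F.2 = segment ℝ (p : ℂ) (p + e₂) :=
  Parallelograms.isOrthogonalFrame_iff hU h𝒬 h𝒮 (mem_rectangles_iff U)

include hU h𝒬 h𝒮 in
/-- **Prop 2.6 (a) at `ℛ(U)`** — the orthogonal-frame BRIDGE instantiated: for an affine germ `linGerm p L` with
`det L ≠ 0`, the germ model's `PreservesOrthFrames` holds IFF its canonical representative maps every
orthogonal frame at `p` (image inside `U`) to an orthogonal frame of `(U, 𝒬)` relative to `ℛ(U)`.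
[cite: MochizukiAbsTopIII2015, Proposition 2.6 (a) p.57] -/
theorem LocGerm.preservesOrthFrames_iff_rectangles (p : U) {L : ℂ →L[ℝ] ℂ}
    (hL : LinearMap.det (L : ℂ →ₗ[ℝ] ℂ) ≠ 0) :
    (LocGerm.linGerm (p : ℂ) L).PreservesOrthFrames ↔
      ∀ (F F' : Set U × Set U) (e₁ e₂ : ℂ),
        Parallelograms.IsOrthogonalFrame 𝒬 {R : Set U | Subtype.val '' R ∈ rectanglesIn U} p F →
        Subtype.val '' F.1 = segment ℝ (p : ℂ) (p + e₁) →
        Subtype.val '' F.2 = segment ℝ (p : ℂ) (p + e₂) →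
        Subtype.val '' F'.1 = segment ℝ (p : ℂ) (p + L e₁) →
        Subtype.val '' F'.2 = segment ℝ (p : ℂ) (p + L e₂) →
        closure (openParallelogram (p : ℂ) (L e₁) (L e₂)) ⊆ U →
        Parallelograms.IsOrthogonalFrame 𝒬 {R : Set U | Subtype.val '' R ∈ rectanglesIn U} p F' :=
  LocGerm.preservesOrthFrames_iff_orthogonalFrames hU h𝒬 h𝒮 (mem_rectangles_iff U) p hL

include hU h𝒬 h𝒮 in
/-- **[AbsTopIII] Prop 2.6 (a) — `𝒜_p` in print's terms, at `ℛ(U)`**: a unit `u` of the germ monoid at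
`p ∈ U` lies in the model's `germAut p` IFF it is an affine germ (compatible with the local additive
structure) mapping frames to frames (`det ≠ 0`) whose canonical representative maps orthogonal frames
(Rmk 2.5.1, rectangles `ℛ(U)`) to orthogonal frames and every frame into its own class of the abstract
orientations `Parallelograms.Orientations 𝒬 p` (Prop 2.5 (d)).
[cite: MochizukiAbsTopIII2015, Proposition 2.6 (a) p.57] -/
theorem mem_germAut_iff_rectangles (p : U) (u : (LocGerm (p : ℂ))ˣ) :
    u ∈ germAut (p : ℂ) ↔ ∃ L : ℂ →L[ℝ] ℂ, (u : LocGerm (p : ℂ)) = LocGerm.linGerm (p : ℂ) L ∧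
      LinearMap.det (L : ℂ →ₗ[ℝ] ℂ) ≠ 0 ∧
      (∀ (F F' : Set U × Set U) (e₁ e₂ : ℂ),
        Parallelograms.IsOrthogonalFrame 𝒬 {R : Set U | Subtype.val '' R ∈ rectanglesIn U} p F →
        Subtype.val '' F.1 = segment ℝ (p : ℂ) (p + e₁) →
        Subtype.val '' F.2 = segment ℝ (p : ℂ) (p + e₂) →
        Subtype.val '' F'.1 = segment ℝ (p : ℂ) (p + L e₁) →
        Subtype.val '' F'.2 = segment ℝ (p : ℂ) (p + L e₂) →
        closure (openParallelogram (p : ℂ) (L e₁) (L e₂)) ⊆ U →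
        Parallelograms.IsOrthogonalFrame 𝒬 {R : Set U | Subtype.val '' R ∈ rectanglesIn U} p F') ∧
      (∀ (F F' : {PF : Set U × (Set U × Set U) // Parallelograms.IsFrameOf 𝒬 p PF.1 PF.2})
        (e₁ e₂ : ℂ), LinearIndependent ℝ ![e₁, e₂] →
        Subtype.val '' F.1.1 = openParallelogram (p : ℂ) e₁ e₂ →
        Subtype.val '' F.1.2.1 = segment ℝ (p : ℂ) (p + e₁) →
        Subtype.val '' F.1.2.2 = segment ℝ (p : ℂ) (p + e₂) →
        Subtype.val '' F'.1.1 = openParallelogram (p : ℂ) (L e₁) (L e₂) →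
        Subtype.val '' F'.1.2.1 = segment ℝ (p : ℂ) (p + L e₁) →
        Subtype.val '' F'.1.2.2 = segment ℝ (p : ℂ) (p + L e₂) →
        (Quot.mk _ F : Parallelograms.Orientations 𝒬 p) = Quot.mk _ F') :=
  mem_germAut_iff_abstract hU h𝒬 h𝒮 (mem_rectangles_iff U) p u

end Instances

end

end Literature.AnabelianGeometry.AbsoluteAnabelian
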